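import Literature.Analysis.FluidPDE.TorusConvectionBounds
import Literature.Analysis.FluidPDE.PeriodicCylinderWordLeibniz
import HarnessLib

/-!
# Word derivatives of bilinear scalars `⟪A, M B⟫` of smooth fields on `T³`: Leibniz and the
# 2-tame `L²` bounds

Analysis/FluidPDE support file for the energy-method construction of Euler flows in the
periodic cylinder (`Literature.Analysis.FluidPDE.KatoLai1984_periodicCylinderUniformExistence`;
Kato–Lai 1984, §4: the pressure estimate `‖QF(u,v)‖_s ≤ c(‖u‖_{s₀}‖v‖_s + ‖u‖_s‖v‖_{s₀})`, (4.4),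
rests on Sobolev product estimates for the scalars `∂ᵢuⱼ ∂ⱼvᵢ` and `|u_h|²`). For smooth real
fields `A, B : T^d → ℝ^d` (`card d = 3`) and a fixed linear map `M`, the scalar
`x ↦ ⟪A x, M (B x)⟫` has

* `wordDeriv_innerCLM_eq_sum_masks` — **the Leibniz formula for words**:
  `∂_w ⟪A, M B⟫ = ∑_μ ⟪∂_{w|μ} A, M ∂_{w|¬μ} B⟫` over the Boolean masks `μ` of the word
  (`maskSel` of `PeriodicCylinderWordLeibniz`);
* `exists_integral_wordDeriv_innerCLM_sq_le` — **the 2-tame `L²` bound**: for every `k` there is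
  `C` with `∫ |∂_w ⟪A, M B⟫|² ≤ C ‖M‖² (lat₂ A · lat_k B + lat_k A · lat₂ B)` for all words
  `|w| ≤ k` (sup × `L²` on the extreme masks via `H² ⊂ L^∞`, `L⁴ × L⁴` via `H¹ ⊂ L⁴` and
  log-convex interpolation with base level `2` on the others, `latProd_le_tame_base`).

Everything is proved; no named fact and no `sorry` is introduced. Constants are existential.

## Mathlib / tree search

Tree: `maskSel`, `maskSel_ofFn_cons`, `not_fin_cons`, `length_maskSel_add` (`PeriodicCylinderWordLeibniz`);
`Torus.partialDeriv_inner`, `Torus.partialDeriv_finset_sum`, `Torus.partialDeriv_clm_comp`;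
`Torus.latNormSq_*`, `Torus.exists_norm_sq_le_latNormSq_two`,
`Torus.exists_integral_norm_pow_four_le_latNormSq_one_sq`, `integral_mul_le_sqrt_mul_sqrt_of_continuous`.

## References

* T. Kato, C. Y. Lai, J. Funct. Anal. 56 (1984) 15–28, §4 (4.4). [KatoLai1984]
* R. Temam, *On the Euler equations of incompressible perfect fluids*, J. Funct. Anal. 20 (1975)
  32–43, Lemma 1.1–1.2 (the pressure estimate). [Temam1975]
-/

noncomputable section

open Filter Topology TopologicalSpace Finset MeasureTheory UnitAddTorus
open scoped ENNReal NNReal InnerProductSpace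

namespace Literature.Analysis.FluidPDE

namespace Torus

open FunctionSpaces FunctionSpaces.Torus GalerkinSmooth

universe u

variable {d : Type u} [Fintype d] [DecidableEq d]

/-! ### The tame pairing of levels with an arbitrary base -/

section Tame

variable {W U : UnitAddTorus d → EuclideanSpace ℝ d}

/-- **The tame pairing of levels with base `b`**: for `b ≤ p`, `b ≤ q`, `p + q = m + b`,
`lat_p W · lat_q U ≤ lat_b W · lat_m U + lat_m W · lat_b U`. [folklore] -/
theorem latProd_le_tame_base (hW : IsSmooth W) (hU : IsSmooth U) {b p q m : ℕ} (hp : b ≤ p) (hq : b ≤ q)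
    (hpq : p + q = m + b) :
    latNormSq p W * latNormSq q U ≤ latNormSq b W * latNormSq m U + latNormSq m W * latNormSq b U := by
  have hpm : p ≤ m := by omega
  have hqm : q ≤ m := by omega
  have hbW := latNormSq_nonneg b W
  have hmW := latNormSq_nonneg m W
  have hbU := latNormSq_nonneg b U
  have hmU := latNormSq_nonneg m U
  rcases eq_or_lt_of_le hp with hpb | hpb
  · subst hpb
    have hqm' : q = m := by omega
    subst hqm'
    linarith [mul_nonneg hmW hbU]
  rcases eq_or_lt_of_le hq with hqb | hqb
  · subst hqb
    have hpm' : p = m := by omega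
    subst hpm'
    linarith [mul_nonneg hbW hmU]
  have hmb : (b : ℝ) < m := by exact_mod_cast (show b < m by omega)
  set θ : ℝ := ((m : ℝ) - p) / ((m : ℝ) - b) with hθ
  have hden : (0 : ℝ) < (m : ℝ) - b := by linarith
  have hpm' : (p : ℝ) < m := by exact_mod_cast (show p < m by omega)
  have hpb' : (b : ℝ) < p := by exact_mod_cast hpb
  have hθ0 : 0 < θ := div_pos (by linarith) hden
  have hθ1 : θ < 1 := by rw [hθ, div_lt_one hden]; linarith
  have hpθ : (p : ℝ) = θ * ((b : ℕ) : ℝ) + (1 - θ) * ((m : ℕ) : ℝ) := by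
    rw [hθ]
    field_simp
    ring
  have hqθ : (q : ℝ) = (1 - θ) * ((b : ℕ) : ℝ) + (1 - (1 - θ)) * ((m : ℕ) : ℝ) := by
    have hq' : (q : ℝ) = m + b - p := by
      have hsum : (p : ℝ) + q = m + b := by exact_mod_cast hpq
      linarith
    rw [hq', hθ]
    field_simp
    ring
  have hIW := latNormSq_interpolate hW hθ0 hθ1 hpθ
  have hIU := latNormSq_interpolate hU (by linarith) (by linarith) hqθ
  rw [sub_sub_cancel] at hIU
  have hY := Real.geom_mean_le_arith_mean2_weighted (w₁ := θ) (w₂ := 1 - θ) hθ0.le (by linarith)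
    (mul_nonneg hbW hmU) (mul_nonneg hmW hbU) (by ring)
  calc latNormSq p W * latNormSq q U
      ≤ (latNormSq b W ^ θ * latNormSq m W ^ (1 - θ)) * (latNormSq b U ^ (1 - θ) * latNormSq m U ^ θ) :=
        mul_le_mul hIW hIU (latNormSq_nonneg q U) (by positivity)
    _ = (latNormSq b W * latNormSq m U) ^ θ * (latNormSq m W * latNormSq b U) ^ (1 - θ) := by
        rw [Real.mul_rpow hbW hmU, Real.mul_rpow hmW hbU]; ring
    _ ≤ θ * (latNormSq b W * latNormSq m U) + (1 - θ) * (latNormSq m W * latNormSq b U) := hY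
    _ ≤ _ := by nlinarith [mul_nonneg hbW hmU, mul_nonneg hmW hbU, hθ0.le]

end Tame

/-! ### The Leibniz formula for words of bilinear scalars -/

section Leibniz

variable {A B : UnitAddTorus d → EuclideanSpace ℝ d}

/-- The selected word derivatives of a smooth field are smooth (bookkeeping). [folklore] -/
theorem isSmooth_wordDeriv_maskSel (hA : IsSmooth A) (w : List d) (μ : List Bool) : IsSmooth (wordDeriv (maskSel w μ) A) :=
  isSmooth_wordDeriv hA _

/-- `∂ᵢ ⟪a, M b⟫ = ⟪∂ᵢ a, M b⟫ + ⟪a, M ∂ᵢ b⟫`. [folklore] -/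
theorem partialDeriv_innerCLM {a b : UnitAddTorus d → EuclideanSpace ℝ d} (ha : IsSmooth a) (hb : IsSmooth b)
    (M : EuclideanSpace ℝ d →L[ℝ] EuclideanSpace ℝ d) (i : d) (x : UnitAddTorus d) :
    Torus.partialDeriv i (fun y => ⟪a y, M (b y)⟫_ℝ) x =
      ⟪Torus.partialDeriv i a x, M (b x)⟫_ℝ + ⟪a x, M (Torus.partialDeriv i b x)⟫_ℝ := by
  have hMb : IsSmooth (fun y => M (b y)) := hb.comp_clm M
  rw [partialDeriv_inner (ha.isContDiff (by simp)) (hMb.isContDiff (by simp)), add_comm]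
  congr 2
  exact partialDeriv_clm_comp hb M i x

/-- **The Leibniz formula for words of `⟪A, M B⟫`** over the Boolean masks of the word. [folklore] -/
theorem wordDeriv_innerCLM_eq_sum_masks (hA : IsSmooth A) (hB : IsSmooth B)
    (M : EuclideanSpace ℝ d →L[ℝ] EuclideanSpace ℝ d) : ∀ w : List d,
    wordDeriv w (fun x => ⟪A x, M (B x)⟫_ℝ) = fun x => ∑ μ : Fin w.length → Bool,
      ⟪wordDeriv (maskSel w (List.ofFn μ)) A x, M (wordDeriv (maskSel w (List.ofFn fun i => !μ i)) B x)⟫_ℝ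
  | [] => by
    funext x
    simp [maskSel]
  | i :: w => by
    have ih := wordDeriv_innerCLM_eq_sum_masks hA hB M w
    funext x
    rw [wordDeriv_cons, ih]
    -- differentiate the finite sum termwise
    have hterm : ∀ μ : Fin w.length → Bool, IsSmooth fun y =>
        ⟪wordDeriv (maskSel w (List.ofFn μ)) A y, M (wordDeriv (maskSel w (List.ofFn fun i => !μ i)) B y)⟫_ℝ :=
      fun μ => (isSmooth_wordDeriv hA _).inner ((isSmooth_wordDeriv hB _).comp_clm M)
    rw [partialDeriv_finset_sum _ (fun μ _ => (hterm μ).isContDiff (by simp)) i x]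
    -- the right-hand side: split the first letter of the mask
    show _ = ∑ μ : Fin (w.length + 1) → Bool, ⟪wordDeriv (maskSel (i :: w) (List.ofFn μ)) A x,
      M (wordDeriv (maskSel (i :: w) (List.ofFn fun j => !μ j)) B x)⟫_ℝ
    rw [sum_fin_succ_fun, Fintype.sum_bool]
    simp only [not_fin_cons, maskSel_ofFn_cons, Bool.not_true, Bool.not_false, if_true, Bool.false_eq_true, if_false,
      List.singleton_append, List.nil_append, wordDeriv_cons, ← Finset.sum_add_distrib]
    refine Finset.sum_congr rfl fun μ _ => ?_
    exact partialDeriv_innerCLM (isSmooth_wordDeriv hA _) (isSmooth_wordDeriv hB _) M i x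

end Leibniz

/-! ### The `L²` bounds -/

section Bounds

variable {A B : UnitAddTorus d → EuclideanSpace ℝ d}

omit [DecidableEq d] in
/-- **Sup × `L²`**: `∫ ‖A‖² ‖G‖² ≤ K lat₂(A) ∫ ‖G‖²` with the `H² ⊂ L^∞` constant. [folklore] -/
theorem integral_norm_sq_mul_norm_sq_le_sup {K : ℝ}
    (hK : ∀ u : UnitAddTorus d → EuclideanSpace ℝ d, IsSmooth u → ∀ x, ‖u x‖ ^ 2 ≤ K * latNormSq 2 u)
    (hA : IsSmooth A) {G : UnitAddTorus d → EuclideanSpace ℝ d} (hG : IsSmooth G) :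
    ∫ x, ‖A x‖ ^ 2 * ‖G x‖ ^ 2 ≤ K * latNormSq 2 A * ∫ x, ‖G x‖ ^ 2 := by
  have hint : Integrable (fun x => ‖G x‖ ^ 2) volume := hG.norm_sq.continuous.integrable_unitAddTorus
  calc ∫ x, ‖A x‖ ^ 2 * ‖G x‖ ^ 2 ≤ ∫ x, (K * latNormSq 2 A) * ‖G x‖ ^ 2 := by
        refine integral_mono_of_nonneg (ae_of_all _ fun x => by positivity) (hint.const_mul _)
          (ae_of_all _ fun x => ?_)
        exact mul_le_mul_of_nonneg_right (hK A hA x) (sq_nonneg _)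
    _ = K * latNormSq 2 A * ∫ x, ‖G x‖ ^ 2 := integral_const_mul _ _

/-- **`L⁴ × L⁴`** for word derivatives: `∫ ‖∂_{w₁}A‖² ‖∂_{w₂}B‖² ≤ K (4π²)^{|w₁|+|w₂|} lat_{|w₁|+1}(A) lat_{|w₂|+1}(B)`
with the `H¹ ⊂ L⁴` constant. [folklore] -/
theorem integral_norm_sq_wordDeriv_mul_le_L4 {K : ℝ} (hK0 : 0 ≤ K)
    (hK : ∀ u : UnitAddTorus d → EuclideanSpace ℝ d, IsSmooth u → ∫ x, ‖u x‖ ^ 4 ≤ K * latNormSq 1 u ^ 2)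
    (hA : IsSmooth A) (hB : IsSmooth B) (w₁ w₂ : List d) :
    ∫ x, ‖wordDeriv w₁ A x‖ ^ 2 * ‖wordDeriv w₂ B x‖ ^ 2 ≤
      K * (4 * Real.pi ^ 2) ^ (w₁.length + w₂.length) * latNormSq (w₁.length + 1) A * latNormSq (w₂.length + 1) B := by
  have hA' := isSmooth_wordDeriv hA w₁
  have hB' := isSmooth_wordDeriv hB w₂
  have h1 := FunctionSpaces.Torus.integral_mul_le_sqrt_mul_sqrt_of_continuous (f := fun x => ‖wordDeriv w₁ A x‖ ^ 2) (g := fun x => ‖wordDeriv w₂ B x‖ ^ 2)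
    (hA'.continuous.norm.pow 2) (hB'.continuous.norm.pow 2) (fun x => sq_nonneg _) (fun x => sq_nonneg _)
  have eA : ∫ x, (‖wordDeriv w₁ A x‖ ^ 2) ^ 2 = ∫ x, ‖wordDeriv w₁ A x‖ ^ 4 := integral_congr_ae (ae_of_all _ fun x => by ring)
  have eB : ∫ x, (‖wordDeriv w₂ B x‖ ^ 2) ^ 2 = ∫ x, ‖wordDeriv w₂ B x‖ ^ 4 := integral_congr_ae (ae_of_all _ fun x => by ring)
  rw [eA, eB] at h1
  have hA4 := sqrt_integral_norm_pow_four_le hK0 hK hA'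
  have hB4 := sqrt_integral_norm_pow_four_le hK0 hK hB'
  have hAl : latNormSq 1 (wordDeriv w₁ A) ≤ (4 * Real.pi ^ 2) ^ w₁.length * latNormSq (w₁.length + 1) A := by
    have := latNormSq_wordDeriv_le hA 1 w₁; rwa [add_comm] at this
  have hBl : latNormSq 1 (wordDeriv w₂ B) ≤ (4 * Real.pi ^ 2) ^ w₂.length * latNormSq (w₂.length + 1) B := by
    have := latNormSq_wordDeriv_le hB 1 w₂; rwa [add_comm] at this
  have h0A := latNormSq_nonneg 1 (wordDeriv w₁ A)
  have h0B := latNormSq_nonneg 1 (wordDeriv w₂ B)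
  have h0A' := latNormSq_nonneg (w₁.length + 1) A
  calc ∫ x, ‖wordDeriv w₁ A x‖ ^ 2 * ‖wordDeriv w₂ B x‖ ^ 2
      ≤ Real.sqrt (∫ x, ‖wordDeriv w₁ A x‖ ^ 4) * Real.sqrt (∫ x, ‖wordDeriv w₂ B x‖ ^ 4) := h1
    _ ≤ (Real.sqrt K * latNormSq 1 (wordDeriv w₁ A)) * (Real.sqrt K * latNormSq 1 (wordDeriv w₂ B)) :=
        mul_le_mul hA4 hB4 (Real.sqrt_nonneg _) (mul_nonneg (Real.sqrt_nonneg _) h0A)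
    _ ≤ (Real.sqrt K * ((4 * Real.pi ^ 2) ^ w₁.length * latNormSq (w₁.length + 1) A)) *
          (Real.sqrt K * ((4 * Real.pi ^ 2) ^ w₂.length * latNormSq (w₂.length + 1) B)) :=
        mul_le_mul (mul_le_mul_of_nonneg_left hAl (Real.sqrt_nonneg _))
          (mul_le_mul_of_nonneg_left hBl (Real.sqrt_nonneg _)) (mul_nonneg (Real.sqrt_nonneg _) h0B)
          (mul_nonneg (Real.sqrt_nonneg _) (by positivity))
    _ = _ := by
        have : Real.sqrt K * Real.sqrt K = K := Real.mul_self_sqrt hK0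
        rw [pow_add]
        linear_combination ((4 * Real.pi ^ 2) ^ w₁.length * latNormSq (w₁.length + 1) A *
          ((4 * Real.pi ^ 2) ^ w₂.length * latNormSq (w₂.length + 1) B)) * this

/-- **The `L²` bound of one mask term**: for `|w₁| + |w₂| ≤ k`,
`∫ ‖∂_{w₁}A‖² ‖∂_{w₂}B‖² ≤ C (lat₂ A · lat_k B + lat_k A · lat₂ B)`. [folklore] -/
theorem exists_integral_norm_sq_wordDeriv_mul_le (hd : Fintype.card d = 3) (k : ℕ) : ∃ C : ℝ, 0 ≤ C ∧
    ∀ (A B : UnitAddTorus d → EuclideanSpace ℝ d), IsSmooth A → IsSmooth B → ∀ (w₁ w₂ : List d),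
      w₁.length + w₂.length ≤ k →
      ∫ x, ‖wordDeriv w₁ A x‖ ^ 2 * ‖wordDeriv w₂ B x‖ ^ 2 ≤
        C * (latNormSq 2 A * latNormSq k B + latNormSq k A * latNormSq 2 B) := by
  obtain ⟨K₂, hK₂0, hK₂⟩ := exists_norm_sq_le_latNormSq_two (d := d) hd
  obtain ⟨K₄, hK₄0, hK₄⟩ := exists_integral_norm_pow_four_le_latNormSq_one_sq (d := d) hd
  set q : ℝ := 4 * Real.pi ^ 2 with hq
  have hq1 : 1 ≤ q := by rw [hq]; nlinarith [Real.pi_gt_three]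
  refine ⟨(K₂ + K₄) * q ^ k, by positivity, fun A B hA hB w₁ w₂ hk => ?_⟩
  have h2A := latNormSq_nonneg 2 A
  have hkA := latNormSq_nonneg k A
  have h2B := latNormSq_nonneg 2 B
  have hkB := latNormSq_nonneg k B
  have hqk : ∀ j ≤ k, q ^ j ≤ q ^ k := fun j hj => pow_le_pow_right₀ hq1 hj
  rcases Nat.eq_zero_or_pos w₁.length with h1 | h1
  · -- `w₁ = []`: sup on `A`
    have hw₁ : w₁ = [] := List.length_eq_zero_iff.1 h1
    subst hw₁
    have h := integral_norm_sq_mul_norm_sq_le_sup hK₂ hA (isSmooth_wordDeriv hB w₂)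
    have hI : ∫ x, ‖wordDeriv w₂ B x‖ ^ 2 ≤ q ^ w₂.length * latNormSq w₂.length B :=
      integral_norm_sq_wordDeriv_le_latNormSq hB le_rfl
    have hmono : latNormSq w₂.length B ≤ latNormSq k B := latNormSq_mono hB (by simpa using hk)
    calc ∫ x, ‖wordDeriv [] A x‖ ^ 2 * ‖wordDeriv w₂ B x‖ ^ 2 ≤ K₂ * latNormSq 2 A * ∫ x, ‖wordDeriv w₂ B x‖ ^ 2 := h
      _ ≤ K₂ * latNormSq 2 A * (q ^ k * latNormSq k B) := by
          refine mul_le_mul_of_nonneg_left (hI.trans ?_) (by positivity)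
          exact mul_le_mul (hqk _ (by simpa using hk)) hmono (latNormSq_nonneg _ _) (by positivity)
      _ = K₂ * q ^ k * (latNormSq 2 A * latNormSq k B) := by ring
      _ ≤ (K₂ + K₄) * q ^ k * (latNormSq 2 A * latNormSq k B + latNormSq k A * latNormSq 2 B) := by
          refine mul_le_mul (mul_le_mul_of_nonneg_right (by linarith) (by positivity)) (by nlinarith [mul_nonneg hkA h2B])
            (by positivity) (by positivity)
  rcases Nat.eq_zero_or_pos w₂.length with h2 | h2
  · -- `w₂ = []`: sup on `B`
    have hw₂ : w₂ = [] := List.length_eq_zero_iff.1 h2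
    subst hw₂
    have h := integral_norm_sq_mul_norm_sq_le_sup hK₂ hB (isSmooth_wordDeriv hA w₁)
    have hI : ∫ x, ‖wordDeriv w₁ A x‖ ^ 2 ≤ q ^ w₁.length * latNormSq w₁.length A :=
      integral_norm_sq_wordDeriv_le_latNormSq hA le_rfl
    have hmono : latNormSq w₁.length A ≤ latNormSq k A := latNormSq_mono hA (by simpa using hk)
    calc ∫ x, ‖wordDeriv w₁ A x‖ ^ 2 * ‖wordDeriv [] B x‖ ^ 2 = ∫ x, ‖B x‖ ^ 2 * ‖wordDeriv w₁ A x‖ ^ 2 :=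
          integral_congr_ae (ae_of_all _ fun x => by simp [mul_comm])
      _ ≤ K₂ * latNormSq 2 B * ∫ x, ‖wordDeriv w₁ A x‖ ^ 2 := h
      _ ≤ K₂ * latNormSq 2 B * (q ^ k * latNormSq k A) := by
          refine mul_le_mul_of_nonneg_left (hI.trans ?_) (by positivity)
          exact mul_le_mul (hqk _ (by simpa using hk)) hmono (latNormSq_nonneg _ _) (by positivity)
      _ = K₂ * q ^ k * (latNormSq k A * latNormSq 2 B) := by ring
      _ ≤ (K₂ + K₄) * q ^ k * (latNormSq 2 A * latNormSq k B + latNormSq k A * latNormSq 2 B) := by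
          refine mul_le_mul (mul_le_mul_of_nonneg_right (by linarith) (by positivity)) (by nlinarith [mul_nonneg h2A hkB])
            (by positivity) (by positivity)
  · -- both words nonempty: `L⁴ × L⁴` and interpolation with base `2`
    have h := integral_norm_sq_wordDeriv_mul_le_L4 hK₄0 hK₄ hA hB w₁ w₂
    -- raise the level of the `A` factor so that the levels add up to `k + 2`
    set p : ℕ := k + 1 - w₂.length with hp
    have hp2 : 2 ≤ p := by omega
    have hq2 : 2 ≤ w₂.length + 1 := by omega
    have hpq : p + (w₂.length + 1) = k + 2 := by omega
    have hmono : latNormSq (w₁.length + 1) A ≤ latNormSq p A := latNormSq_mono hA (by omega)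
    have htame := latProd_le_tame_base hA hB (b := 2) (p := p) (q := w₂.length + 1) (m := k) hp2 hq2 hpq
    calc ∫ x, ‖wordDeriv w₁ A x‖ ^ 2 * ‖wordDeriv w₂ B x‖ ^ 2
        ≤ K₄ * q ^ (w₁.length + w₂.length) * latNormSq (w₁.length + 1) A * latNormSq (w₂.length + 1) B := h
      _ ≤ K₄ * q ^ k * (latNormSq p A * latNormSq (w₂.length + 1) B) := by
          have h0p := latNormSq_nonneg p A
          have h0w := latNormSq_nonneg (w₁.length + 1) A
          have h0q := latNormSq_nonneg (w₂.length + 1) B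
          rw [mul_assoc (K₄ * q ^ (w₁.length + w₂.length))]
          exact mul_le_mul (mul_le_mul_of_nonneg_left (hqk _ hk) hK₄0)
            (mul_le_mul_of_nonneg_right hmono h0q) (by positivity) (by positivity)
      _ ≤ K₄ * q ^ k * (latNormSq 2 A * latNormSq k B + latNormSq k A * latNormSq 2 B) :=
          mul_le_mul_of_nonneg_left htame (by positivity)
      _ ≤ (K₂ + K₄) * q ^ k * (latNormSq 2 A * latNormSq k B + latNormSq k A * latNormSq 2 B) := by
          refine mul_le_mul_of_nonneg_right (mul_le_mul_of_nonneg_right (by linarith) (by positivity)) ?_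
          positivity

/-- **The 2-tame `L²` bound for word derivatives of `⟪A, M B⟫`**: for every `k` there is `C` with
`∫ |∂_w ⟪A, M B⟫|² ≤ C ‖M‖² (lat₂ A · lat_k B + lat_k A · lat₂ B)` for all smooth real fields
`A, B`, all `M` and all words `|w| ≤ k`. [cite: KatoLai1984, §4 (4.4)] -/
theorem exists_integral_wordDeriv_innerCLM_sq_le (hd : Fintype.card d = 3) (k : ℕ) : ∃ C : ℝ, 0 ≤ C ∧
    ∀ (A B : UnitAddTorus d → EuclideanSpace ℝ d), IsSmooth A → IsSmooth B →
      ∀ (M : EuclideanSpace ℝ d →L[ℝ] EuclideanSpace ℝ d) (w : List d), w.length ≤ k →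
      ∫ x, (wordDeriv w (fun y => ⟪A y, M (B y)⟫_ℝ) x) ^ 2 ≤
        C * ‖M‖ ^ 2 * (latNormSq 2 A * latNormSq k B + latNormSq k A * latNormSq 2 B) := by
  obtain ⟨C, hC0, hC⟩ := exists_integral_norm_sq_wordDeriv_mul_le (d := d) hd k
  refine ⟨(2 : ℝ) ^ k * (2 : ℝ) ^ k * C, by positivity, fun A B hA hB M w hw => ?_⟩
  have h2A := latNormSq_nonneg 2 A
  have hkA := latNormSq_nonneg k A
  have h2B := latNormSq_nonneg 2 B
  have hkB := latNormSq_nonneg k B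
  set N : ℕ := Fintype.card (Fin w.length → Bool) with hN
  have hNle : (N : ℝ) ≤ (2 : ℝ) ^ k := by
    rw [hN, Fintype.card_fun, Fintype.card_bool, Fintype.card_fin]
    exact_mod_cast Nat.pow_le_pow_right (by norm_num) hw
  -- the mask terms
  set T : (Fin w.length → Bool) → UnitAddTorus d → ℝ := fun μ x =>
    ⟪wordDeriv (maskSel w (List.ofFn μ)) A x, M (wordDeriv (maskSel w (List.ofFn fun i => !μ i)) B x)⟫_ℝ with hT
  have hTs : ∀ μ, IsSmooth (T μ) := fun μ => (isSmooth_wordDeriv hA _).inner ((isSmooth_wordDeriv hB _).comp_clm M)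
  have hTint : ∀ μ, Integrable (fun x => T μ x ^ 2) volume := fun μ => ((hTs μ).continuous.pow 2).integrable_unitAddTorus
  -- each mask term in `L²`
  have hTb : ∀ μ, ∫ x, T μ x ^ 2 ≤ C * ‖M‖ ^ 2 * (latNormSq 2 A * latNormSq k B + latNormSq k A * latNormSq 2 B) := by
    intro μ
    have hlen := length_maskSel_add w μ rfl
    have hpt : ∀ x, T μ x ^ 2 ≤ ‖M‖ ^ 2 * (‖wordDeriv (maskSel w (List.ofFn μ)) A x‖ ^ 2 *
        ‖wordDeriv (maskSel w (List.ofFn fun i => !μ i)) B x‖ ^ 2) := by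
      intro x
      have h1 : |T μ x| ≤ ‖M‖ * (‖wordDeriv (maskSel w (List.ofFn μ)) A x‖ *
          ‖wordDeriv (maskSel w (List.ofFn fun i => !μ i)) B x‖) := by
        calc |T μ x| ≤ ‖wordDeriv (maskSel w (List.ofFn μ)) A x‖ *
              ‖M (wordDeriv (maskSel w (List.ofFn fun i => !μ i)) B x)‖ := abs_real_inner_le_norm _ _
          _ ≤ ‖wordDeriv (maskSel w (List.ofFn μ)) A x‖ *
              (‖M‖ * ‖wordDeriv (maskSel w (List.ofFn fun i => !μ i)) B x‖) :=
              mul_le_mul_of_nonneg_left (M.le_opNorm _) (norm_nonneg _)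
          _ = _ := by ring
      calc T μ x ^ 2 = |T μ x| ^ 2 := (sq_abs _).symm
        _ ≤ (‖M‖ * (‖wordDeriv (maskSel w (List.ofFn μ)) A x‖ *
            ‖wordDeriv (maskSel w (List.ofFn fun i => !μ i)) B x‖)) ^ 2 :=
            pow_le_pow_left₀ (abs_nonneg _) h1 2
        _ = _ := by ring
    have hint2 : Integrable (fun x => ‖M‖ ^ 2 * (‖wordDeriv (maskSel w (List.ofFn μ)) A x‖ ^ 2 *
        ‖wordDeriv (maskSel w (List.ofFn fun i => !μ i)) B x‖ ^ 2)) volume :=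
      ((((isSmooth_wordDeriv hA _).continuous.norm.pow 2).mul
        ((isSmooth_wordDeriv hB _).continuous.norm.pow 2)).integrable_unitAddTorus).const_mul _
    calc ∫ x, T μ x ^ 2 ≤ ∫ x, ‖M‖ ^ 2 * (‖wordDeriv (maskSel w (List.ofFn μ)) A x‖ ^ 2 *
          ‖wordDeriv (maskSel w (List.ofFn fun i => !μ i)) B x‖ ^ 2) :=
          integral_mono_of_nonneg (ae_of_all _ fun x => sq_nonneg _) hint2 (ae_of_all _ hpt)
      _ = ‖M‖ ^ 2 * ∫ x, ‖wordDeriv (maskSel w (List.ofFn μ)) A x‖ ^ 2 *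
          ‖wordDeriv (maskSel w (List.ofFn fun i => !μ i)) B x‖ ^ 2 := integral_const_mul _ _
      _ ≤ ‖M‖ ^ 2 * (C * (latNormSq 2 A * latNormSq k B + latNormSq k A * latNormSq 2 B)) :=
          mul_le_mul_of_nonneg_left (hC A B hA hB _ _ (by rw [hlen]; exact hw)) (sq_nonneg _)
      _ = _ := by ring
  -- Cauchy–Schwarz over the masks
  rw [wordDeriv_innerCLM_eq_sum_masks hA hB M w]
  have hcs : ∀ x, (∑ μ : Fin w.length → Bool, T μ x) ^ 2 ≤ N * ∑ μ : Fin w.length → Bool, T μ x ^ 2 := fun x => by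
    have := sq_sum_le_card_mul_sum_sq (s := (univ : Finset (Fin w.length → Bool))) (f := fun μ => T μ x)
    rwa [card_univ] at this
  calc ∫ x, (∑ μ : Fin w.length → Bool, T μ x) ^ 2
      ≤ ∫ x, N * ∑ μ : Fin w.length → Bool, T μ x ^ 2 :=
        integral_mono_of_nonneg (ae_of_all _ fun x => sq_nonneg _)
          ((integrable_finsetSum _ fun μ _ => hTint μ).const_mul _) (ae_of_all _ hcs)
    _ = N * ∑ μ : Fin w.length → Bool, ∫ x, T μ x ^ 2 := by
        rw [integral_const_mul, integral_finsetSum _ fun μ _ => hTint μ]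
    _ ≤ N * ∑ _μ : Fin w.length → Bool, C * ‖M‖ ^ 2 * (latNormSq 2 A * latNormSq k B + latNormSq k A * latNormSq 2 B) :=
        mul_le_mul_of_nonneg_left (sum_le_sum fun μ _ => hTb μ) (Nat.cast_nonneg _)
    _ = (N : ℝ) * N * (C * ‖M‖ ^ 2 * (latNormSq 2 A * latNormSq k B + latNormSq k A * latNormSq 2 B)) := by
        rw [sum_const, card_univ, ← hN, nsmul_eq_mul]; ring
    _ ≤ (2 : ℝ) ^ k * (2 : ℝ) ^ k * (C * ‖M‖ ^ 2 * (latNormSq 2 A * latNormSq k B + latNormSq k A * latNormSq 2 B)) := by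
        have hprod : 0 ≤ C * ‖M‖ ^ 2 * (latNormSq 2 A * latNormSq k B + latNormSq k A * latNormSq 2 B) := by positivity
        exact mul_le_mul_of_nonneg_right (mul_le_mul hNle hNle (Nat.cast_nonneg _) (by positivity)) hprod
    _ = _ := by ring

end Bounds


end Torus

end Literature.Analysis.FluidPDE
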